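import Summits.SmoothPoincare4.SmoothPoincare4.Theorems.EntropyRungMargerinRailsDefs
import Literature.Geometry.Riemannian.GurskyEinsteinGapProofs
import Mathlib.Algebra.Order.BigOperators.Ring.Finset
import HarnessLib

/-!
# Margerin's polynomial inequality — the matrix side (line `margerin-cone-hamilton-rails`,
# stub `stub_margerinPolynomial` of crux `EntropyRung.ChangGurskyYang`, item stmt-SmoothPoincare4-10834)

The block-level algebra behind the lead's proof of STUB 1 (`stub_margerinPolynomial`, Margerin 1998
Prop. 4 at `β = 2` in margin form) of the line `margerin-cone-hamilton-rails`:

* `margerinP2_eq_four_mul` — on the Bianchi locus (`A`, `C` symmetric, `tr A = tr C = t`) Margerin's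
  fundamental polynomial expands as `P₂ = 4Q`,
  `Q = −t²(‖Å‖² + ⅔‖B‖² + ‖C̊‖²) − (‖Å‖² + 2‖B‖² + ‖C̊‖²)‖B‖² + 3t(3 det Å + 3 det C̊ + ⟨Å, BBᵀ⟩ + ⟨C̊, BᵀB⟩ + 4 det B)`
  (`Å = A − (t/3)1`; one `ring` identity in the 21 block coordinates, using explicit entries of
  Hamilton's `M^#`, `sharp_apply_ij`);
* the three DECOUPLING inequalities that reduce `Q` to four scalar invariants:
  (M1) `six_mul_sq_three_det_le` — `6(3 det Å)² ≤ ‖Å‖⁶` (the tree's `GurskyLeBrun.det_sq_le`,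
  nonnegativity of the discriminant of a real symmetric `3 × 3` matrix);
  (M2) `frobPairing_sq_le_traceFree` — `⟨Å, S⟩² ≤ ‖Å‖² ‖S̊‖²` (Cauchy–Schwarz; the identity component
  of `S = BBᵀ` is invisible to the trace-free `Å`);
  (M3) `newton_det_sq_le` — `108‖B‖² det B² ≤ (2‖B‖⁴ − 3‖S̊‖²)²`, Newton's `3e₁e₃ ≤ e₂²` for the
  squared singular values of `B`, proved WITHOUT spectral theory from `(B^#)^# = det B · B`,
  the Cauchy–Binet identity `‖N^#‖² = (‖N‖⁴ − ‖NNᵀ‖²)/2` and `(tr P)² ≤ 3‖P‖²`;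
  this is the coupling between `det B` (large only near `SO(3)`) and the anisotropy of `BBᵀ`
  (large only at low rank) on which Margerin's inequality hinges;
* bookkeeping: `‖BBᵀ‖² ≤ ‖B‖⁴`, `‖(BᵀB)°‖ = ‖(BBᵀ)°‖`, trace-free splitting of `‖·‖²`.

References: C. Margerin, Comm. Anal. Geom. 6 (1998), Part I, Prop. 4, Lemma 5 [Margerin1998];
R. S. Hamilton, J. Differential Geom. 24 (1986), §2 (p. 157, `M^#`), §6 (p. 166) [Hamilton1986];
M. J. Gursky, C. LeBrun, Ann. Global Anal. Geom. 17 (1999), §3 [GurskyLebrun1999].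
-/

noncomputable section

-- every `Summit.SmoothPoincare4.SmoothPoincare4.…` name repeats the summit = sub-problem segment (D-0017 layout)
set_option linter.dupNamespace false

open Set
open scoped Matrix BigOperators

namespace Summit.SmoothPoincare4.SmoothPoincare4.Theorems.MargerinRails

open Literature.Geometry.Riemannian Literature.Geometry.Riemannian.HamiltonODE

/-! ## Entries of Hamilton's `M^#` -/

section SharpEntries
variable (M : Matrix (Fin 3) (Fin 3) ℝ)

/-- `(M^#)₀₀ = M₁₁M₂₂ − M₁₂M₂₁`. [cite: Hamilton1986, §2, p. 157] -/
@[simp] theorem sharp_apply_00 : M.sharp 0 0 = M 1 1 * M 2 2 - M 1 2 * M 2 1 := by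
  simp [Matrix.sharp, Matrix.adjugate_fin_three]
/-- `(M^#)₀₁ = −M₁₀M₂₂ + M₁₂M₂₀`. [cite: Hamilton1986, §2, p. 157] -/
@[simp] theorem sharp_apply_01 : M.sharp 0 1 = -(M 1 0 * M 2 2) + M 1 2 * M 2 0 := by
  simp [Matrix.sharp, Matrix.adjugate_fin_three]
/-- `(M^#)₀₂ = M₁₀M₂₁ − M₁₁M₂₀`. [cite: Hamilton1986, §2, p. 157] -/
@[simp] theorem sharp_apply_02 : M.sharp 0 2 = M 1 0 * M 2 1 - M 1 1 * M 2 0 := by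
  simp [Matrix.sharp, Matrix.adjugate_fin_three]
/-- `(M^#)₁₀ = −M₀₁M₂₂ + M₀₂M₂₁`. [cite: Hamilton1986, §2, p. 157] -/
@[simp] theorem sharp_apply_10 : M.sharp 1 0 = -(M 0 1 * M 2 2) + M 0 2 * M 2 1 := by
  simp [Matrix.sharp, Matrix.adjugate_fin_three]
/-- `(M^#)₁₁ = M₀₀M₂₂ − M₀₂M₂₀`. [cite: Hamilton1986, §2, p. 157] -/
@[simp] theorem sharp_apply_11 : M.sharp 1 1 = M 0 0 * M 2 2 - M 0 2 * M 2 0 := by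
  simp [Matrix.sharp, Matrix.adjugate_fin_three]
/-- `(M^#)₁₂ = −M₀₀M₂₁ + M₀₁M₂₀`. [cite: Hamilton1986, §2, p. 157] -/
@[simp] theorem sharp_apply_12 : M.sharp 1 2 = -(M 0 0 * M 2 1) + M 0 1 * M 2 0 := by
  simp [Matrix.sharp, Matrix.adjugate_fin_three]
/-- `(M^#)₂₀ = M₀₁M₁₂ − M₀₂M₁₁`. [cite: Hamilton1986, §2, p. 157] -/
@[simp] theorem sharp_apply_20 : M.sharp 2 0 = M 0 1 * M 1 2 - M 0 2 * M 1 1 := by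
  simp [Matrix.sharp, Matrix.adjugate_fin_three]
/-- `(M^#)₂₁ = −M₀₀M₁₂ + M₀₂M₁₀`. [cite: Hamilton1986, §2, p. 157] -/
@[simp] theorem sharp_apply_21 : M.sharp 2 1 = -(M 0 0 * M 1 2) + M 0 2 * M 1 0 := by
  simp [Matrix.sharp, Matrix.adjugate_fin_three]
/-- `(M^#)₂₂ = M₀₀M₁₁ − M₀₁M₁₀`. [cite: Hamilton1986, §2, p. 157] -/
@[simp] theorem sharp_apply_22 : M.sharp 2 2 = M 0 0 * M 1 1 - M 0 1 * M 1 0 := by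
  simp [Matrix.sharp, Matrix.adjugate_fin_three]

end SharpEntries

/-! ## The expansion of `P₂` on the Bianchi locus -/

set_option maxRecDepth 100000 in -- the `ring` normal form of the 21-variable quartic is deep
/-- **`P₂ = 4Q` on the Bianchi locus.** For symmetric `A`, `C` with `tr A = tr C = t`, writing
`Å = A − (t/3)1`, `C̊ = C − (t/3)1`, Margerin's fundamental polynomial is
`P₂ = 4·(−t²(‖Å‖² + ⅔‖B‖² + ‖C̊‖²) − (‖Å‖² + 2‖B‖² + ‖C̊‖²)‖B‖² + 3t(3 det Å + 3 det C̊ + ⟨Å, BBᵀ⟩ + ⟨C̊, BᵀB⟩ + 4 det B))`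
(Hamilton's `⟨p, p²+p^#⟩ = tr A³ + tr C³ + 6 det A + 6 det C + 3 tr(ABBᵀ) + 3 tr(CBᵀB) + 12 det B`,
`tr A·adj A = 3 det A`, and `tr Å³ = 3 det Å` for the trace-free parts). A polynomial identity in the
21 block coordinates, checked by `ring`. [cite: Margerin1998, Part I, Lemma 5] [cite: Hamilton1986, §6, p. 166] -/
theorem margerinP2_eq_four_mul (A B C : Matrix (Fin 3) (Fin 3) ℝ) (hA : A.IsSymm) (hC : C.IsSymm)
    (htr : A.trace = C.trace) :
    margerinP2 (A, B, C) =
      4 * (-(A.trace ^ 2 * (frobSq (A - (A.trace / 3) • (1 : Matrix (Fin 3) (Fin 3) ℝ)) +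
            2 / 3 * frobSq B + frobSq (C - (A.trace / 3) • (1 : Matrix (Fin 3) (Fin 3) ℝ)))) -
          (frobSq (A - (A.trace / 3) • (1 : Matrix (Fin 3) (Fin 3) ℝ)) + 2 * frobSq B +
            frobSq (C - (A.trace / 3) • (1 : Matrix (Fin 3) (Fin 3) ℝ))) * frobSq B +
          3 * A.trace * (3 * (A - (A.trace / 3) • (1 : Matrix (Fin 3) (Fin 3) ℝ)).det +
            3 * (C - (A.trace / 3) • (1 : Matrix (Fin 3) (Fin 3) ℝ)).det +
            (∑ i, ∑ j, (A - (A.trace / 3) • (1 : Matrix (Fin 3) (Fin 3) ℝ)) i j * (B * Bᵀ) i j) +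
            (∑ i, ∑ j, (C - (A.trace / 3) • (1 : Matrix (Fin 3) (Fin 3) ℝ)) i j * (Bᵀ * B) i j) +
            4 * B.det)) := by
  have h10 : A 1 0 = A 0 1 := hA.apply 0 1
  have h20 : A 2 0 = A 0 2 := hA.apply 0 2
  have h21 : A 2 1 = A 1 2 := hA.apply 1 2
  have k10 : C 1 0 = C 0 1 := hC.apply 0 1
  have k20 : C 2 0 = C 0 2 := hC.apply 0 2
  have k21 : C 2 1 = C 1 2 := hC.apply 1 2
  have hc22 : C 2 2 = A 0 0 + A 1 1 + A 2 2 - C 0 0 - C 1 1 := by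
    simp only [Matrix.trace, Matrix.diag_apply, Fin.sum_univ_three] at htr
    linarith
  simp only [margerinP2, pairing, scal, devNormSq, rmNormSq, frobSq, field,
    Matrix.trace, Matrix.diag_apply, Fin.sum_univ_three, Matrix.mul_apply, Matrix.add_apply,
    Matrix.smul_apply, Matrix.sub_apply, Matrix.transpose_apply, Matrix.one_apply,
    Matrix.det_fin_three, smul_eq_mul, sharp_apply_00, sharp_apply_01, sharp_apply_02,
    sharp_apply_10, sharp_apply_11, sharp_apply_12, sharp_apply_20, sharp_apply_21, sharp_apply_22]
  simp only [h10, h20, h21, k10, k20, k21, hc22, Fin.isValue, Fin.reduceEq, if_true, if_false,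
    mul_one, mul_zero, sub_zero]
  ring


/-! ## Frobenius bookkeeping -/

/-- `‖Xᵀ‖² = ‖X‖²`. [folklore] -/
theorem frobSq_transpose (X : Matrix (Fin 3) (Fin 3) ℝ) : frobSq Xᵀ = frobSq X := by
  simp only [frobSq, Matrix.transpose_apply, Fin.sum_univ_three]
  ring

/-- `‖c • X‖² = c² ‖X‖²`. [folklore] -/
theorem frobSq_smul (c : ℝ) (X : Matrix (Fin 3) (Fin 3) ℝ) : frobSq (c • X) = c ^ 2 * frobSq X := by
  simp only [frobSq, Matrix.smul_apply, smul_eq_mul, Fin.sum_univ_three]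
  ring

/-- `‖X‖² = 0 ⇒ X = 0`. [folklore] -/
theorem eq_zero_of_frobSq_eq_zero {X : Matrix (Fin 3) (Fin 3) ℝ} (h : frobSq X = 0) : X = 0 := by
  have hij : ∀ i j, X i j ^ 2 = 0 := by
    intro i j
    have hrow : ∀ i ∈ Finset.univ, (0 : ℝ) ≤ ∑ j, X i j ^ 2 :=
      fun i _ ↦ Finset.sum_nonneg fun _ _ ↦ sq_nonneg _
    have h1 := (Finset.sum_eq_zero_iff_of_nonneg hrow).mp h i (Finset.mem_univ _)
    exact (Finset.sum_eq_zero_iff_of_nonneg (fun _ _ ↦ sq_nonneg _)).mp h1 j (Finset.mem_univ _)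
  ext i j
  simpa using hij i j

/-- **Trace-free splitting of the Frobenius norm**: `‖X‖² = ‖X − (tr X/3)1‖² + (tr X)²/3`. [folklore] -/
theorem frobSq_eq_traceFree_add (X : Matrix (Fin 3) (Fin 3) ℝ) :
    frobSq X = frobSq (X - (X.trace / 3) • (1 : Matrix (Fin 3) (Fin 3) ℝ)) + X.trace ^ 2 / 3 := by
  simp only [frobSq, Matrix.trace, Matrix.diag_apply, Fin.sum_univ_three, Matrix.sub_apply,
    Matrix.smul_apply, Matrix.one_apply, smul_eq_mul, Fin.isValue, Fin.reduceEq, if_true, if_false,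
    mul_one, mul_zero, sub_zero]
  ring

/-- `‖S − (tr S/3)1‖² = ‖S‖² − (tr S)²/3`. [folklore] -/
theorem frobSq_traceFree (S : Matrix (Fin 3) (Fin 3) ℝ) :
    frobSq (S - (S.trace / 3) • (1 : Matrix (Fin 3) (Fin 3) ℝ)) = frobSq S - S.trace ^ 2 / 3 := by
  have := frobSq_eq_traceFree_add S
  linarith

/-- The trace-free part is symmetric when `X` is. [folklore] -/
theorem isSymm_traceFree {X : Matrix (Fin 3) (Fin 3) ℝ} (hX : X.IsSymm) (c : ℝ) :
    (X - c • (1 : Matrix (Fin 3) (Fin 3) ℝ)).IsSymm := by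
  have hXt : Xᵀ = X := hX
  change (X - c • (1 : Matrix (Fin 3) (Fin 3) ℝ))ᵀ = X - c • 1
  rw [Matrix.transpose_sub, Matrix.transpose_smul, Matrix.transpose_one, hXt]

/-- The trace-free part is trace-free. [folklore] -/
theorem trace_traceFree (X : Matrix (Fin 3) (Fin 3) ℝ) :
    (X - (X.trace / 3) • (1 : Matrix (Fin 3) (Fin 3) ℝ)).trace = 0 := by
  rw [Matrix.trace_sub, Matrix.trace_smul, Matrix.trace_one, Fintype.card_fin]
  simp only [Nat.cast_ofNat, smul_eq_mul]
  ring

/-! ## The three decoupling inequalities -/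

/-- **(M1) the trace-free cubic bound** (`54 det Å² ≤ ‖Å‖⁶`, the discriminant of a real symmetric
`3 × 3` matrix is nonnegative; tree theorem `GurskyLeBrun.det_sq_le`), in the form
`6 (3 det Å)² ≤ (‖Å‖²)³`. [cite: GurskyLebrun1999, §3, proof of Lemma 4] -/
theorem six_mul_sq_three_det_le {X : Matrix (Fin 3) (Fin 3) ℝ} (hX : X.IsSymm) :
    6 * (3 * (X - (X.trace / 3) • (1 : Matrix (Fin 3) (Fin 3) ℝ)).det) ^ 2 ≤
      frobSq (X - (X.trace / 3) • (1 : Matrix (Fin 3) (Fin 3) ℝ)) ^ 3 := by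
  have h := GurskyLeBrun.det_sq_le (X - (X.trace / 3) • (1 : Matrix (Fin 3) (Fin 3) ℝ))
    (isSymm_traceFree hX _) (trace_traceFree X)
  simp only [frobSq]
  nlinarith [h]

/-- **(M2) Cauchy–Schwarz for the Frobenius pairing**: `⟨X, Y⟩² ≤ ‖X‖² ‖Y‖²`. [folklore] -/
theorem frobPairing_sq_le (X Y : Matrix (Fin 3) (Fin 3) ℝ) :
    (∑ i, ∑ j, X i j * Y i j) ^ 2 ≤ frobSq X * frobSq Y := by
  have h := Finset.sum_mul_sq_le_sq_mul_sq (Finset.univ : Finset (Fin 3 × Fin 3))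
    (fun x ↦ X x.1 x.2) (fun x ↦ Y x.1 x.2)
  simp only [Finset.univ_product_univ.symm, Finset.sum_product] at h
  simpa only [frobSq] using h

/-- Pairing against a trace-free matrix kills the identity component: `⟨Å, S⟩ = ⟨Å, S − c·1⟩`. [folklore] -/
theorem frobPairing_traceFree_left {Z : Matrix (Fin 3) (Fin 3) ℝ} (hZ : Z.trace = 0)
    (S : Matrix (Fin 3) (Fin 3) ℝ) (c : ℝ) :
    ∑ i, ∑ j, Z i j * S i j = ∑ i, ∑ j, Z i j * (S - c • (1 : Matrix (Fin 3) (Fin 3) ℝ)) i j := by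
  simp only [Matrix.trace, Matrix.diag_apply, Fin.sum_univ_three] at hZ
  simp only [Fin.sum_univ_three, Matrix.sub_apply, Matrix.smul_apply, Matrix.one_apply, smul_eq_mul,
    Fin.isValue, Fin.reduceEq, if_true, if_false, mul_one, mul_zero, sub_zero]
  have : Z 2 2 = -Z 0 0 - Z 1 1 := by linarith
  rw [this]
  ring

/-- **(M2′)** `⟨Å, S⟩² ≤ ‖Å‖² · ‖S̊‖²` for trace-free `Å`, `S̊ = S − (tr S/3)1`. [folklore] -/
theorem frobPairing_sq_le_traceFree {Z : Matrix (Fin 3) (Fin 3) ℝ} (hZ : Z.trace = 0)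
    (S : Matrix (Fin 3) (Fin 3) ℝ) :
    (∑ i, ∑ j, Z i j * S i j) ^ 2 ≤
      frobSq Z * frobSq (S - (S.trace / 3) • (1 : Matrix (Fin 3) (Fin 3) ℝ)) := by
  rw [frobPairing_traceFree_left hZ S (S.trace / 3)]
  exact frobPairing_sq_le _ _

/-- **Cauchy–Binet / Lagrange identity for `3 × 3` matrices**: the sum of the squared `2 × 2` minors
is `‖N^#‖² = (‖N‖⁴ − ‖N Nᵀ‖²)/2`. [folklore] -/
theorem frobSq_sharp (N : Matrix (Fin 3) (Fin 3) ℝ) :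
    frobSq N.sharp = (frobSq N ^ 2 - frobSq (N * Nᵀ)) / 2 := by
  simp only [frobSq, Fin.sum_univ_three, Matrix.mul_apply, Matrix.transpose_apply, sharp_apply_00,
    sharp_apply_01, sharp_apply_02, sharp_apply_10, sharp_apply_11, sharp_apply_12, sharp_apply_20,
    sharp_apply_21, sharp_apply_22]
  ring

/-- `(tr P)² ≤ 3 ‖P‖²` (Cauchy–Schwarz on the diagonal). [folklore] -/
theorem trace_sq_le_three_mul_frobSq (P : Matrix (Fin 3) (Fin 3) ℝ) : P.trace ^ 2 ≤ 3 * frobSq P := by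
  simp only [frobSq, Matrix.trace, Matrix.diag_apply, Fin.sum_univ_three]
  nlinarith [sq_nonneg (P 0 0 - P 1 1), sq_nonneg (P 0 0 - P 2 2), sq_nonneg (P 1 1 - P 2 2),
    sq_nonneg (P 0 1), sq_nonneg (P 0 2), sq_nonneg (P 1 0), sq_nonneg (P 1 2), sq_nonneg (P 2 0),
    sq_nonneg (P 2 1)]

/-- **Maclaurin for singular values**: `3 ‖N^#‖² ≤ ‖N‖⁴` for every real `3 × 3` matrix
(`e₁(s²)² ≥ 3 e₂(s²)`). [folklore] -/
theorem three_mul_frobSq_sharp_le (N : Matrix (Fin 3) (Fin 3) ℝ) : 3 * frobSq N.sharp ≤ frobSq N ^ 2 := by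
  rw [frobSq_sharp]
  have h1 := trace_sq_le_three_mul_frobSq (N * Nᵀ)
  rw [trace_mul_transpose_self] at h1
  linarith

/-- `adj (adj B) = det B · B` for `3 × 3` matrices, in `#`-form: `(B^#)^# = det B · B`. [folklore] -/
theorem sharp_sharp (B : Matrix (Fin 3) (Fin 3) ℝ) : B.sharp.sharp = B.det • B := by
  unfold Matrix.sharp
  rw [← Matrix.adjugate_transpose, Matrix.transpose_transpose,
    Matrix.adjugate_adjugate B (by simp [Fintype.card_fin]), Fintype.card_fin]
  simp

/-- **(M3) Newton's inequality for `S = BBᵀ`** (`3 e₁ e₃ ≤ e₂²` on the squared singular values):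
`108 ‖B‖² (det B)² ≤ (2‖B‖⁴ − 3‖S̊‖²)²` with `‖S̊‖² = ‖BBᵀ‖² − ‖B‖⁴/3` — the coupling between
`det B` (large only for `B` close to `SO(3)`) and the anisotropy of `BBᵀ` (large only for `B` of
low rank) that Margerin's inequality hinges on. [cite: Margerin1998, Part I, Lemma 5] -/
theorem newton_det_sq_le : ∀ B : Matrix (Fin 3) (Fin 3) ℝ,
    108 * frobSq B * B.det ^ 2 ≤ (2 * frobSq B ^ 2 - 3 * (frobSq (B * Bᵀ) - frobSq B ^ 2 / 3)) ^ 2 := by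
  intro B
  -- `N = B^#`: `‖N^#‖² = det B² ‖B‖²`, `‖N‖² = e₂ = (‖B‖⁴ − ‖BBᵀ‖²)/2`, and `3‖N^#‖² ≤ ‖N‖⁴`
  have h1 : frobSq B.sharp.sharp = B.det ^ 2 * frobSq B := by rw [sharp_sharp, frobSq_smul]
  have h2 : frobSq B.sharp = (frobSq B ^ 2 - frobSq (B * Bᵀ)) / 2 := frobSq_sharp B
  have h3 := three_mul_frobSq_sharp_le B.sharp
  rw [h1, h2] at h3
  nlinarith [h3]

/-- `‖BBᵀ‖² ≤ ‖B‖⁴` (i.e. `e₂ ≥ 0`), so the anisotropy ratio `r² = 3‖S̊‖²/(2‖B‖⁴)` is at most `1`. [folklore] -/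
theorem frobSq_mul_transpose_le (B : Matrix (Fin 3) (Fin 3) ℝ) : frobSq (B * Bᵀ) ≤ frobSq B ^ 2 := by
  have h := frobSq_nonneg B.sharp
  rw [frobSq_sharp] at h
  linarith

/-- `‖BᵀB‖² = ‖BBᵀ‖²` and `tr BᵀB = tr BBᵀ`: the anisotropies of `BᵀB` and `BBᵀ` agree. [folklore] -/
theorem frobSq_traceFree_transpose_mul (B : Matrix (Fin 3) (Fin 3) ℝ) :
    frobSq (Bᵀ * B - ((Bᵀ * B).trace / 3) • (1 : Matrix (Fin 3) (Fin 3) ℝ)) =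
      frobSq (B * Bᵀ - ((B * Bᵀ).trace / 3) • (1 : Matrix (Fin 3) (Fin 3) ℝ)) := by
  rw [frobSq_traceFree, frobSq_traceFree, Matrix.trace_mul_comm]
  congr 1
  simp only [frobSq, Fin.sum_univ_three, Matrix.mul_apply, Matrix.transpose_apply]
  ring


end Summit.SmoothPoincare4.SmoothPoincare4.Theorems.MargerinRails

end
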